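import Summits.QuantumFields.YangMills.Theorems.BalabanUVNodesN12BillH12ForStub1VWK1AxV11OfJunctionRowsWindowLocal
import Summits.QuantumFields.YangMills.Theorems.BalabanUVNodesN12AtRecord13Prop1KnitThm1MemGuardedRowsDatumScaleLettersDischargedAtLengthOfRegNameAndStepOfRecordTermPinnedAx

/-!
# BalabanUVNodes ∕ N12 → K1ᴬ — «MEMORY-GUARDED ROWS» EDITION of the h12 BILL (supersedes F4 ✓p835078): N12's BILL `h12` FOR `stub_nodes13PWSVW` FROM N12's JUNCTION ROWS with the
# (R-a′) PER-RUN MEMORY GUARD — conclusion `∃ λW γ₁₂, 0 < γ₁₂ ∧ (∀ P, 1 ≤ P.K → λW.kSel P < P.K) ∧ ∀ P, λW.kSel P < P.K → Step.InInterval γ₁₂ P.K (gOfRecord₁₃Ax θL P) →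
# N0OfRecord₁₃Ax θL P (λW.kSel P + 1) ≤ λW.kSel P + 1 → B15Leaf (WOfRecord₁₃Ax θL λW P)`, `θL := Θ.liveRepin₁₃Ax F 2` — the [IV] pin on every run INSIDE THE WINDOW WHOSE MEMORY FITS

Cell `pub-ymgap` (HUMAN RULING D-0062), seat `pub-ymgap-dag-n12-d` g39 (R134 N12 [B15] s2 «knit at the record»); helper of K1ᴬ `stmt-QuantumFields-27239` (DECIDING), `--kind proof
--supports … --as helper`, count-neutral.  Sibling of `BalabanUVNodesN12BillH12ForStub1VWK1AxV11OfJunctionRowsWindowLocal` (this seat g39 ✓p835078; imported — every `open`, every letter and the statement are that file's,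
byte-kept except the DECLARED EDITS below); the junction opened and re-packed is the «memory-guarded rows» Ax junction
`BalabanUVNodesN12AtRecord13Prop1KnitThm1MemGuardedRowsDatumScaleLettersDischargedAtLengthOfRegNameAndStepOfRecordTermPinnedAx` (this seat g39).

WHY (LOCATED-g39-2 «SHORT RUNS», bus 2026-08-31T21:24–21:50Z; MISSING ESTIMATE N12 #57 OF RECORD (lit-balaban lead g47, typer g57, iface-1 g184), LOCATED-NEGATIVE: [IV] states and
proves (1.89) only for a density carrying `N > N₀` previous one-step operations — p.177 (ii), p.178 «h = k − N», p.179 «We assume that N > N₀», p.198 under (1.94); no short-run ∕ first-steps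
form exists in [IV] §1 or [III] §3).  ✓p835078 displays 12P §1's level row `tNk : ∀ P, λ.kSel P < P.K → (window) → N0OfRecord₁₃Ax θL P (λ.kSel P + 1) ≤ λ.kSel P + 1` next to the step row
`hk : λ.kSel P = P.K − 1`, the box `tup : BetaUpperH β′ γβ β(θL)`, `tS : SmallnessFor γβ …` and `hr1 : 1 ≤ r`; but the box alone puts a K = 1 run in the window and there `2 ≤ N₀`
(dag-n12-e `two_le_N0OfSeq_of_hist ∘ one_lt_log_pow_of_inInterval_hist`; this seat's probe `ShortRunProbe.not_tNk_at_length_one`; dag-n24-c g27's sharpening; ref-Q g17 KERNEL NOTE 1 (V4)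
`f4_rows_false`): the displayed rows of ✓p835078 are JOINTLY UNSATISFIABLE — it is VACUOUS as a conditional (its superseded parent ✓p813747 likewise).  The located collision is at the text
level: the rung-1ⱽᵂ text asks the [IV] pin on EVERY windowed run with `1 ≤ P.K`, print asks it only where the memory fits.  The repair in print's own scope is ✦ plan g104's one-clause
K1ᴬ v11.3 candidate ((R-a′): `∀ P, kSel P < P.K → smallCouplings → N0OfRecord₁₃Ax θ P (kSel P + 1) ≤ kSel P + 1 → (rBasicStep ↔ B15Leaf …)`); THIS FILE is the N12 half of that token:
the bill's conclusion carries the SAME guard, token for token, and no displayed row is refutable from its neighbours by the K = 1 road any more.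

DECLARED EDITS relative to ✓p835078 (inside the `∀ Θ λ` block; the (J0′) head, `h15`, `hstep`, `Adm`'s rows, `ν₀`'s rows, the step row `hk`, the ν₀-pin, the Θ-level rows `hr1 hA₀ tup tS
t10`, the σ-only rows, the thresholds, the radius, the tolerance rows byte-identical).  (M1) the row `tNk` DELETED; (M2) the nine remaining coupling-dependent per-run rows `hmassLive tNN tN₀
tΛ L91h L95 L91 L97 L80` read `(∀ P, lam.kSel P < P.K → Step.InInterval γβ P.K (gOfRecord₁₃Ax F 2 (Θ.liveRepin₁₃Ax F 2) P) → N0OfRecord₁₃Ax (Θ.liveRepin₁₃Ax F 2) P (lam.kSel P + 1) ≤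
lam.kSel P + 1 → …) →`; (M3) the CONCLUSION's per-run clause gains `N0OfRecord₁₃Ax (Θ.liveRepin₁₃Ax F 2) P (lamW.kSel P + 1) ≤ lamW.kSel P + 1 →` as third antecedent; (M4) proof =
✓p835078's re-packing keyed to G3 (`λW := λᴾ` verbatim, `γ₁₂ := γβ`, `0 < γ₁₂ := tS.γ_pos`), `tNk` dropped from the `intro` line and from the `hmain` call.  Namespace
`…OfJunctionRowsMemGuarded`, theorem `h12_bill_at_liveRepin₁₃Ax_of_junctionRowsMemGuarded`.

HOW THE PAYER READS IT (dag-n24-c's engine (U)∕(W), binder `h12F`, once ✦ re-registers rung 1ⱽᵂ with the guard and (Q)∕(T)∕(W) split on «kSel < K ∧ memory fits»): unchanged from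
✓p835078's note — `γβ ≤ γ` (2.7)-small (`tS ∕ t10` by `N12AtTheta13OfThm1CCMWSmallWindow.smallnessFor_half_two_one ∕ gamma_mul_p0Profile_le_tenth`), `tlow ∕ tup` = the prefix's boxes on
`]0, γβ]`, `bβ := bl` with `0 ≤ bl` displayed, `hr1 ∕ hA₀` numerics of `Θ.ν`; `tNN` is payable by the free choice `Nm P := N0OfRecord₁₃Ax θL P (kSel P + 1)`.

HONEST FRAMING.  Re-packaging (`∃`-introduction + arithmetic on `kSel`) over the «memory-guarded rows» junction; EVERY displayed row of that junction stays displayed and LEADS ((R) name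
`h15` + THE ONE-LENGTH STEP TOKEN `hstep` (N07, no producer), `Adm`'s rows, the ν₀-pin, NODE 00's `hres` ∕ live mass, the term-pin data + 12P §1's residual rows, the β-sign box, the
Θ-level numerics, print's p. 200 conditions, `Λ ≠ ∅`, the ℍ-leaves + (1.80) at the pinned letters, the (J0′) head's instance ∕ cap ∕ budget ∕ tolerance rows); A2 (joint
satisfiability of the ≈ 90 rows) NOT exhibited — only the located K = 1 contradiction is removed; nothing of Bałaban asserted; the bill is NOT paid here; `stub_nodes13PWSVW` NOT closed
(its registered v11.2 text still asks the unguarded pin — ✦ ∕ ★★★'s act); N12 NOT discharged; K0ᴬ ∕ K1ᴬ ∕ K3ᴬ OPEN (K1ᴬ 0∕6); counts unmoved (discharged 8∕27 · K 1∕4); one finite 𝕋⁴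
programme at fixed `ε = L^{-K}` — NOT continuum ∕ ℝ⁴ ∕ OS; NOT the Yang–Mills mass gap (Clay).  THEOREMS ONLY (0 `def`, 0 `sorry`).
Sources (bookkeeping only): [Balaban1989LargeFieldI] (0.2)–(0.6) p.176, p.177 (ii), (1.2) p.178, p.179, Prop. 1 (1.78) p.194, (1.80) p.195, (1.89) p.198, p.200, (1.99)–(1.102)
pp.200–201; [Balaban1985Variational] Thm 1 (8) p.279, Prop. 2 p.281, Prop. 9 (190) pp.308–309; [Balaban1988Convergent] (2.4)–(2.9) pp.255–256, (3.22)–(3.25) pp.269–270;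
[Balaban1987RG1] Thm 1 p.259, §1 p.264, (2.9) p.266.
-/

noncomputable section

open scoped BigOperators ENNReal
open MeasureTheory
open scoped Matrix.Norms.L2Operator
open MeasureTheory Set Finset Metric Filter
open scoped Matrix.Norms.L2Operator BigOperators Matrix RealInnerProductSpace Real InnerProductSpace Topology

namespace Summit.QuantumFields.YangMills.BalabanUVNodes.N12BillH12ForStub1VWK1AxV11OfJunctionRowsMemGuarded

open Summit.QuantumFields.YangMills.BalabanUVNodes.N12AtRecord13Prop1KnitThm1MemGuardedRowsDatumScaleLettersDischargedAtLengthOfRegNameAndStepOfRecordTermPinnedAx (exists_constants_thresholds_radius_areg_pinLF_b15Leaf_WOfRecord₁₃_pinAllΛΩχZ_N0_liveRepin₁₃_memGuardedRowsDatumScale_lettersDischargedAtLength_termPinned_ofRegNameGB_ofStepGB_ax)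

open Literature.MathematicalPhysics.QuantumFieldTheory.Balaban1983to89.B15DeterminingSetsB
open Literature.MathematicalPhysics.QuantumFieldTheory.Balaban1983to89
open Literature.MathematicalPhysics.QuantumFieldTheory.Balaban1983to89.T4Continuum (T4Family LStep Letter walk walkEnd netDisp holAt)
open Literature.MathematicalPhysics.QuantumFieldTheory.Balaban1983to89.DagBinding
open Literature.MathematicalPhysics.QuantumFieldTheory.Balaban1983to89.Node00
open FlowStep (prefixOf BetaLowerH BetaUpperH)
open B15Claim189Assembly (new189 chiPP dom half)
open B15 (Prop1Printed Ineq180)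
open B15.BasicStep (Claim189)
open B8Eq17ClassAkV1 (plaqsOf)
open B14.Eq216Concrete (inputs feeds)
open GaugeGroup (dist1)
open GaugeField (plaqHol gaugeAct)
open B15RPrime1100OfRep (rPrimeDataOfSel)
open T4CubeChartGnomonic (SU2)
open B15Prop1ChartSU2 (su2Chart)
open B15Prop1SliceCoordinates (GaugeSlice ιA)
open T4AxialGaugeSmallField (castSite boxPlaqs boxBonds)
open B6BondElimination (unitVec)
open B6TreeGaugePoincare (curl)
open B16Eq18Proof (box)
open B15Extension193 (extend)
open B15ShellGauge193 (shellGauge)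
open B15Sect1Instances (fun177stdB)
open B14.Eq213DetSet (Bj maxDomT)
open B14.Eq213MaximalDomains (side)
open B14.Eq22Determines (blockIter IsBlockUnion)
open Literature.MathematicalPhysics.QuantumFieldTheory.BalabanImbrieJaffe1984to88.BIJ85Eq453GaugeField (qsstarGIter0)
open B16Sect1Backgrounds (expMul toMS)
open B15DeterminingSets (pts DetBackground genSet IsMinimizer MSField avgFamily bondsOf DetSet embIter AgreeOn)
open B5Eq118OneStroke (iterBlockOf)
open Literature.MathematicalPhysics.QuantumFieldTheory.Balaban1983to89.Node00 (coeField constrEnumB)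
open B15Eq112TorusCover (lift)
open ExpMeanLog (deltaSU)
open B15Prop1Carrier (lfVarOn InstOn InstOn.std InstOn.stdB plaqsInside)
open Summit.QuantumFields.YangMills.BalabanUVNodes.N12AtRecord13Prop1KnitThm1WindowDirectDatumScaleLettersDischargedAtLengthOfRegNameAndStepOfRecord (thm1LetterT_atLength_pTop_of_variationalThm1RegSepCoP7MGB_lamTop)
open B15Claim189Assembly (Setting189)
open B14DomainGeom (Pt)
open B15.PrelimIntegrations (Ineq191 Ineq195)
open B15Chi124DetSets (E124)
open B15Claim189PrintedConditions (omegaOfChain)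
open B15Claim189PinsOfHistory (N0OfRecord₁₃)
open B15Claim189LambdaPin (enlD)
open Summit.QuantumFields.YangMills.BalabanUVNodes.N12MinimiserFamilyKnitRowThm1LettersAtLengthOnZOfRecordBR (exists_R_hMinRow_of_thm1LettersAtLength_alongOrbit_onZ_ofRecord)
open Summit.QuantumFields.YangMills.BalabanUVNodes.N12Thm1LettersAtLengthOfK0GridGB (thm1LetterT_atLength_of_variationalThm1RegSepCoP7MGB)
open B15Prop1NumericsThresholds (plaqSmallOn_of_le)
open B15Prop1MinimiserClassAtDatumScaleAtLengthB (isMinimizerB_withEps_base_of_thm1AtLength isMinimizerB_withEps_of_norm_lt_atLength lamBondsSeq_congr)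
open Summit.QuantumFields.YangMills.BalabanUVNodes.N12DirectChartPackageOfClassRowL1FamilyB (exists_hWD_chartHalf_of_class_uniform_rowl1_family)
open Summit.QuantumFields.YangMills.BalabanUVNodes.N12Prop1DirectOfClassOnlyRowL1UniformBLam (exists_rowPreimageProxiesLetter_family_uniformB_lamBondsSeq)
open Summit.QuantumFields.YangMills.BalabanUVNodes.N12Prop1DirectOfClassOnlyB (exists_curvatureLetters_family)
open Summit.QuantumFields.YangMills.BalabanUVNodes.N12MinimiserFamilyKnitRowThm1Letters (boxRow3_of_boxRow5)
open T4AdjointCovarianceUnitary (lieSU)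
open B15Prop1GradientFromNearValueAtCoPRecord (far_letter_of_box)
open B15Prop1AnalyticExtClause (cplxVec anExt)
open B15Prop1ChartCalculusSU2 (E3)
open B15Sect1Instances (lamDatumP)
open B11Thm1ExistsUniqueTokensGB (VariationalThm1EUSepCoP7MGB VariationalThm1EUStepCoP7MGB)
open B11Thm1ExistsUniqueInductionG (truncSeq)
open Summit.QuantumFields.YangMills.BalabanUVNodes.N12EUStepTokensAtRealisedDataLam (variationalThm1EUSepCoP7MGB_realised_of_step_of_reg_lamTop)
open Summit.QuantumFields.YangMills.BalabanUVNodes.N12Thm1LettersAtLengthOfK0GridGB (blockSat_torusClassSeq)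
open Summit.QuantumFields.YangMills.BalabanUVNodes.N12Thm1LettersAtLengthOfK0GridGB (thm1LetterEU_atLength_of_variationalThm1EUSepCoP7MGB)
open B15Claim189PinsOfHistory (N0OfRecord₁₃Chi N0OfRecord₁₃Ax)
open B14FlowStep (SmallnessFor)


section
variable {F : T4Family}

/-- ★★ **«MEMORY-GUARDED ROWS» EDITION (dag-n12-d g39, LOCATED-g39-2 ∕ MISSING ESTIMATE N12 #57 of record ∕ ref-Q g17 KERNEL NOTE 1: 12P §1's level row `tNk : N₀(θL,P,kSel+1) ≤ kSel+1` — print's «N > N₀», [IV] p.179 — is no longer a displayed row but the PER-RUN MEMORY GUARD of the bill's own conclusion, in ✦ plan g104's (R-a′) currency; every coupling-dependent per-run row is asked on the runs inside the window whose memory fits; the «window-local rows» bill ✓p835078 it supersedes is VACUOUS as a conditional (its rows `hk tup tS hr1 tNk` contradict at the K = 1 window run); CONCLUSION = the (R-a′) h12 body) of N12's BILL `h12` OF `stub_nodes13PWSVW` (dag-n24-c g24 (Q) `…N24Stub1VWShareK1AxV11` §4, bills AT A WITNESS FAMILY) FROM N12's JUNCTION ROWS** — the window-local junction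
at the re-centred record (✓p812482) with its final block RE-PACKAGED as (Q)'s N12 bill body: `∃ λW γ₁₂, 0 < γ₁₂ ∧ (∀ P, 1 ≤ P.K → λW.kSel P < P.K) ∧ ∀ P, λW.kSel P < P.K →
Step.InInterval γ₁₂ P.K (gOfRecord₁₃Ax θL P) → B15Leaf (WOfRecord₁₃Ax θL λW P)` at `θL := Θ.liveRepin₁₃Ax F 2` — which IS (Q)'s `h12` body at `θ.toStage13Params` for every member of a
witness family BUILT ON THE RE-PIN, definitionally (the face's family `theta13OfThm1CCMWZBAx … = (theta13OfNumericsZ …).liveRepin₁₃Ax`: `(θ).liveRepin₁₃Ax = θ` by `rfl`, kernel-checked).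
Witnesses: `λW := λᴾ` = the junction's fully pinned layer (LF pinned to the Prop-1 carrier on `areg`, (1.100) by `pinRPrime₁₃Ax`, (1.80)∕(1.89) by `pinD189ΛH` on the term-pin data
`σ sq Nm p₁`) at the step `λ.kSel P = P.K − 1` (new leading row `hk`; then `1 ≤ P.K → λW.kSel P < P.K` is arithmetic), `γ₁₂ := γβ` = the level of the displayed β-sign box (new sign row
`0 < γβ`).  EVERY OTHER ROW OF ✓p812482 LEADS, VERBATIM ((R) name `h15` + THE ONE-LENGTH STEP TOKEN `hstep` (N07, no producer), `Adm`'s rows, the ν₀-pin, NODE 00's `hres` ∕ live-mass, the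
term-pin data + 12P §1's per-run rows, `BetaLowerH bβ γβ (betaOfRecord₁₃Ax θL)`, (2.8a), the ℍ-leaves + (1.80) at the pinned letters, the (J0′) head's instance ∕ cap ∕ budget ∕ tolerance rows
under `∃ R` ∕ `∀ eR` ∕ `∀ δ`).  NOT a discharge of N12; the bill is PAID only when those rows are.
[cite: Balaban1989LargeFieldI, (0.2)–(0.6) p.176, (1.2) p.178, Prop. 1 (1.77)–(1.78) p.194, (1.80) p.195, (1.89) p.198, (1.99)–(1.102) pp.200–201; Balaban1985Variational, Thm 1 (8) p.279, Prop. 2 p.281, Prop. 9 (190) pp.308–309; Balaban1988Convergent, (2.8) p.256, (3.22)–(3.25) pp.269–270; Balaban1987RG1, Thm 1 p.259, (2.9) p.266] -/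
theorem h12_bill_at_liveRepin₁₃Ax_of_junctionRowsMemGuarded
    (hd3 : ∀ P : B12.RunParams, 3 ≤ (F.P P.K).d)
    (h0 : ∀ P : B12.RunParams, 0 < (F.P P.K).d)
    (ι : B12.RunParams → Type)
    {B₃ a₀ a₁' : ℝ}
    (Z Λ : ∀ P : B12.RunParams, ι P → Set (Site (F.P P.K) 0))
    (k : ∀ P : B12.RunParams, ι P → ℕ)
    (M : ∀ P : B12.RunParams, ι P → ℝ)
    (hk0 : ∀ (P : B12.RunParams) (i : ι P), 0 < k P i)
    (hk1 : ∀ (P : B12.RunParams) (i : ι P), k P i + 1 ≤ (F.P P.K).m + (F.P P.K).K)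
    (T : ∀ (P : B12.RunParams) (i : ι P), Finset (PBond (F.P P.K) (k P i)))
    (lo hi : ∀ P : B12.RunParams, ι P → Fin (F.P P.K).d → ℤ)
    (n : ∀ P : B12.RunParams, ι P → ℕ)
    (hn : ∀ (P : B12.RunParams) (i : ι P) κ, hi P i κ ≤ lo P i κ + n P i)
    (hN : ∀ (P : B12.RunParams) (i : ι P), n P i + 2 < (F.P P.K).sitesPerDir (k P i))
    (hbox : ∀ (P : B12.RunParams) (i : ι P), pts (k P i) (Λ P i) = (castSite '' Set.Icc (lo P i) (hi P i) : Set (Site (F.P P.K) (k P i))))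
    (hZ : ∀ (P : B12.RunParams) (i : ι P), (boxPlaqs (lo P i - 1) (hi P i + 1) : Set (Plaq (F.P P.K) (k P i))) ⊆ plaqsInside (pts (k P i) (Z P i)))
    (hTG0 : ∀ (P : B12.RunParams) (i : ι P), T P i = (box (fun κ => (hi P i κ - lo P i κ + 1).toNat) (lo P i)).image fun x =>
      (⟨castSite (x - unitVec ⟨0, h0 P⟩), ⟨0, h0 P⟩⟩ : PBond (F.P P.K) (k P i)))
    (hN5 : ∀ (P : B12.RunParams) (i : ι P) κ, ((hi P i κ - lo P i κ + 1).toNat : ℤ) + 5 < (F.P P.K).sitesPerDir (k P i))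
    (Kb : ∀ P : B12.RunParams, ι P → ℕ)
    (hK1 : ∀ (P : B12.RunParams) (i : ι P), 1 ≤ Kb P i)
    (hKn : ∀ (P : B12.RunParams) (i : ι P) κ, (hi P i κ - lo P i κ + 1).toNat ≤ Kb P i)
    (ext : ∀ (P : B12.RunParams) (i : ι P), GaugeField (F.P P.K) (k P i) SU2 → GaugeField (F.P P.K) (k P i) SU2)
    (hext : ∀ (P : B12.RunParams) (i : ι P) Vk, ext P i Vk = extend (pts (k P i) (Λ P i)) (shellGauge Vk (lo P i) (hi P i)) Vk)
    (hlohi : ∀ (P : B12.RunParams) (i : ι P), lo P i ≤ hi P i)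
    (LO HI : ∀ P : B12.RunParams, ι P → Fin (F.P P.K).d → ℤ)
    (hLO : ∀ (P : B12.RunParams) (i : ι P), LO P i ≤ lo P i - 1)
    (hHI : ∀ (P : B12.RunParams) (i : ι P), hi P i + 1 ≤ HI P i)
    (n' : ∀ P : B12.RunParams, ι P → ℕ)
    (hn' : ∀ (P : B12.RunParams) (i : ι P) κ, HI P i κ ≤ LO P i κ + n' P i)
    (hn'N : ∀ (P : B12.RunParams) (i : ι P), n' P i < (F.P P.K).sitesPerDir (k P i))
    (hR' : ∀ (P : B12.RunParams) (i : ι P), (boxPlaqs (LO P i) (HI P i) : Set (Plaq (F.P P.K) (k P i))) ⊆ plaqsInside (pts (k P i) (Z P i)))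
    {γ₈ bx : B12.RunParams → ℝ}
    (hγ : ∀ P : B12.RunParams, 0 < γ₈ P)
    (hbx : ∀ P : B12.RunParams, 0 ≤ bx P)
    (hbxM : ∀ (P : B12.RunParams) (i : ι P), 12 * ((F.P P.K).d : ℝ) * ((n P i : ℝ) + 2) ^ 2 ≤ bx P * (M P i) ^ 2)
    (hM : ∀ (P : B12.RunParams) (i : ι P), 1 ≤ (M P i))
    (W : ∀ P : B12.RunParams, ι P → Finset (Plaq (F.P P.K) 0))
    (hWbox : ∀ (P : B12.RunParams) (i : ι P), ∀ q : Plaq (F.P P.K) 0, q.src ∈ ((box (fun κ => (F.P P.K).L ^ (k P i) * ((hi P i κ - lo P i κ + 1).toNat + 3 + 1) - 1) (fun κ => ((F.P P.K).L : ℤ) ^ (k P i) * (lo P i κ - 2))).image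
        (fun z => (castSite z : Site (F.P P.K) 0))) → q ∈ W P i)
    (c : ∀ P : B12.RunParams, ι P → ℕ)
    (hkc : ∀ (P : B12.RunParams) (i : ι P), k P i + c P i ≤ (F.P P.K).m + (F.P P.K).K)
    (hc : ∀ (P : B12.RunParams) (i : ι P), 4 * (F.P P.K).d + (3 * ((F.P P.K).d * (((F.P P.K).L - 1) / 2)) + 5) + 3 < 2 * (F.P P.K).L ^ c P i)
    (X : ∀ P : B12.RunParams, ι P → Set (Site (F.P P.K) 0))
    (D₀ : ∀ P : B12.RunParams, ι P → ℕ)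
    (hBox : ∀ (P : B12.RunParams) (i : ι P), ∀ x ∈ X P i, ∀ w : List (Letter (F.P P.K).d),
      w.length ≤ (∑ i' ∈ Finset.range (k P i + 1), ((F.P P.K).d * (((F.P P.K).L ^ i' - 1) / 2) + 1)) + (3 * ((F.P P.K).d * (((F.P P.K).L - 1) / 2)) + 5) * (F.P P.K).L ^ k P i + (F.P P.K).L ^ k P i →
      ∀ μ : Fin (F.P P.K).d, (⟨B14.Eq22Determines.blockIter (k P i) (walkEnd x w), μ⟩ : PBond (F.P P.K) (k P i)) ∈ (boxBonds (LO P i) (HI P i) : Set (PBond (F.P P.K) (k P i))))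
    (hWX : ∀ (P : B12.RunParams) (i : ι P), ∀ p ∈ W P i, p.src ∈ X P i ∧ p.src.shift p.μ ∈ X P i ∧ p.src.shift p.ν ∈ X P i ∧ (p.src.shift p.μ).shift p.ν ∈ X P i ∧ (p.src.shift p.ν).shift p.μ ∈ X P i)
    (hfeedsX : ∀ (P : B12.RunParams) (i : ι P) (ν' : Fin (F.P P.K).d), ∀ z ∈ box (fun κ => (hi P i κ - lo P i κ + 1).toNat + 3) (fun κ => lo P i κ - 2), ∀ b₀ : PBond (F.P P.K) 0,
      (b₀ ∈ feeds (k P i) (⟨(castSite z : Site (F.P P.K) (k P i)), ⟨0, h0 P⟩⟩ : PBond (F.P P.K) (k P i)) ∨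
        b₀ ∈ feeds (k P i) (⟨((castSite z : Site (F.P P.K) (k P i))).shift ⟨0, h0 P⟩, ν'⟩ : PBond (F.P P.K) (k P i)) ∨
        b₀ ∈ feeds (k P i) (⟨((castSite z : Site (F.P P.K) (k P i))).shift ν', ⟨0, h0 P⟩⟩ : PBond (F.P P.K) (k P i)) ∨
        b₀ ∈ feeds (k P i) (⟨(castSite z : Site (F.P P.K) (k P i)), ν'⟩ : PBond (F.P P.K) (k P i))) → b₀.src ∈ X P i ∧ b₀.tgt ∈ X P i)
    {cE cA : B12.RunParams → ℝ}
    (hcE0 : ∀ P : B12.RunParams, 0 ≤ cE P)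
    (hcE : ∀ (P : B12.RunParams) (i : ι P), 12 * ((F.P P.K).d : ℝ) * ((n P i : ℝ) + 2) ^ 2 ≤ cE P)
    (hγle : ∀ (P : B12.RunParams) (i : ι P), γ₈ P / (M P i) ^ 5 ≤ 1 / 2 / (2 * (3 * (Kb P i : ℝ) ^ 2 + 2 * (Kb P i : ℝ) ^ 4)))
    (hZblk : ∀ (P : B12.RunParams) (i : ι P), IsBlockUnion (k P i) (Z P i))
    (hB₃ : 0 < B₃)
    -- [15] THEOREM 1 (8) = (R), GUARD-GENERIC NAMED FACT in K0⁷'s house AT PRINT's CURRENCY `(lamDatum F, dataSmall7LamTopOf F 2)` (`Adm : StepGuard F`; at `Adm := A‴(c,c₀,c₁)` and the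
    -- stub's constants = K0⁷'s V23 stub 1ᴮ `K0V23Defs.Prop8StepCoPGridGBAt` through k0-s1-w1's 53′; INHABITED there by `K0Stub1BHolds` ∕ this seat's 112 — at GENERIC constants: displayed)
    (Adm : Node00.StepGuard F) (h15 : VariationalThm1RegSepCoP7MGB F 2 Adm (lamDatum F) (dataSmall7LamTopOf F 2) B₃ a₀ a₁')
    -- THE GUARD's TWO STRUCTURAL ROWS print's induction (11)–(14) reads: the standing range and stability under truncation (`truncSeq`); at `A‴` both are arithmetic (dag-n12-c ✓p782972)
    (hAdmK : ∀ ν M' g K k' (s : SeqOfRecord F ν M' g K k'), Adm ν M' g K k' s → k' ≤ (F.P K).m + (F.P K).K)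
    (hAdmTr : ∀ ν M' g K k' (s : SeqOfRecord F ν M' g K (k' + 1)), 0 < k' → Adm ν M' g K (k' + 1) s → Adm ν M' g K k' (truncSeq s))
    -- THE (J0′) HEAD's SKELETON ROWS AT εreg-BLIND NUMERICS `ν₀` (the head of record ✓p740879 is instantiated at `ν₀`; `Θ.ν` is pinned to `ν₀` off the class threshold below)
    (ν₀ : Node00.Stage7Numerics)
    (hdiv₀ : ∀ (P : B12.RunParams) (i : ι P), side (F.P P.K).L ν₀.M₁ (k P i) ∣ (F.P P.K).sitesPerDir 0)
    (hfloor₀ : ∀ P : B12.RunParams, ((F.P P.K).d + 14) * (F.P P.K).L ≤ ν₀.M₁)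
    (hMrad₀ : ∀ P : B12.RunParams, (4 * (F.P P.K).d + (3 * ((F.P P.K).d * (((F.P P.K).L - 1) / 2)) + 5)) * (F.P P.K).L ^ 2 + 2 * (F.P P.K).d * (F.P P.K).L + 12 ≤ ν₀.M₁)
    (hM₁₀ : ∀ P : B12.RunParams, (((F.P P.K).d + 4) * (F.P P.K).L + 6) * (F.P P.K).L ^ 2 ≤ ν₀.M₁)
    -- THE GUARD ROW at the head's εreg-blind numerics `ν₀`, per instance, along the degenerate history `(M, g) := (ν₀.M₁, 1)` (β's `hadm`; at `A‴`: `c ≤ ν₀.M₁`, `k P i + c₀ ≤ m + K`, `L^{c₁} ∣ ν₀.M₁`)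
    (hadm₀ : ∀ (P : B12.RunParams) (i : ι P) (s₁ : SeqOfRecord F ν₀ ν₀.M₁ (fun _ => (1 : ℝ)) P.K (k P i)), Adm ν₀ ν₀.M₁ (fun _ => (1 : ℝ)) P.K (k P i) s₁)
    -- the BOX SCOPE row of the head (every `k`-bond inside `Z^{(k)}` is a bond of the region box)
    (hscope : ∀ (P : B12.RunParams) (i : ι P), {e : PBond (F.P P.K) (k P i) | e.src ∈ pts (k P i) (Z P i) ∧ e.tgt ∈ pts (k P i) (Z P i)} ⊆ boxBonds (LO P i) (HI P i))
    -- the analytic family's bound scale (`𝓐₀ P i := 4·𝓐₁`)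
    (𝓐₁ : ℝ) (h𝓐₁ : 1 < 𝓐₁)
    -- IN PLACE OF [15] THEOREM 1 (E∕U)'s NAME: THE ONE-LENGTH STEP TOKEN ᴮ at the SAME guard and the SAME constants, print's currency `(lamDatum F, dataSmall7LamTopOf F 2)`, for any ONE `C₁` with
    -- `2L³ ≤ C₁`, `8L³ < C₁B₃` ([15] Prop. 2 + Sects. B–E at ONE length given `U₀` with (14); «INHABITED BY»: OPEN — N07's obligation; the (E∕U)ᴮ name AT REGULAR-REALISED DATA follows from it
    -- and `h15` by dag-n12-c g38's `variationalThm1EUSepCoP7MGB_realised_of_step_of_reg_lamTop` ✓p782780 — SUPPLY-at-1 ∕ LIFT proved there)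
    {C₁ : ℝ} (hC₁ : 2 * (F.L : ℝ) ^ 3 ≤ C₁) (hCB : 8 * (F.L : ℝ) ^ 3 < C₁ * B₃)
    (hstep : VariationalThm1EUStepCoP7MGB F 2 Adm (lamDatum F) (dataSmall7LamTopOf F 2) C₁ B₃ a₀ a₁') :
    -- THE THREE THRESHOLDS of the (J0′) head, announced from (ν₀, P.K, Z P i, k P i, the two [15] names) BEFORE Θ ∕ the class threshold ∕ the data budget (U4-existential, instance-dependent)
    ∃ ρJ εW δ₀ : ∀ P : B12.RunParams, ι P → ℝ, (∀ P i, 0 < ρJ P i) ∧ (∀ P i, 0 < εW P i) ∧ (∀ P i, 0 < δ₀ P i) ∧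
    -- THE NINE LETTER CONSTANTS of the chart half (`C ρ Kτ ρτ ρ5`), the (P4)′ row (`εH B₁`), the small-below ∕ curvature letters (`ρ6 M₂`) — functions of `(P.K, k P)`, from the uniform producers
    ∃ C ρ Kτ ρτ ρ5 εH B₁ ρ6 M₂ : ∀ P : B12.RunParams, ι P → ℝ, (∀ P i, 0 ≤ C P i) ∧ (∀ P i, 0 < ρ P i) ∧ (∀ P i, 0 ≤ Kτ P i) ∧ (∀ P i, 0 < ρτ P i) ∧ (∀ P i, 0 < ρ5 P i) ∧
      (∀ P i, 0 < εH P i) ∧ (∀ P i, 0 ≤ B₁ P i) ∧ (∀ P i, 0 < ρ6 P i) ∧ (∀ P i, 0 ≤ M₂ P i) ∧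
    ∀ (Θ : Stage13Params F 2) (lam : ResidW F 2), (∀ P : B12.RunParams, lam.kSel P = P.K - 1) → { ν₀ with εreg := Θ.ν.εreg } = Θ.ν →
      (Θ.HasResidualsOfRecord F 2) →
      -- «WINDOW-LOCAL ROWS» (dag-n12-d g39): the window level `γβ` (= the bill's `γ₁₂`) + β-sign box FIRST; NEW Θ-level rows in place of 12P §1's `tlog tε0 tε1 tflow` (+ `tβ₀0 tβ₀ tγ0 tγ1`)
      ∀ (β₀ bβ γβ : ℝ), (0 ≤ bβ) → (BetaLowerH bβ γβ (betaOfRecord₁₃Ax F 2 (Θ.liveRepin₁₃Ax F 2))) →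
      (1 ≤ Θ.ν.r) → (0 ≤ Θ.ν.A₀) → ∀ (β' : ℝ), (BetaUpperH β' γβ (betaOfRecord₁₃Ax F 2 (Θ.liveRepin₁₃Ax F 2))) → ∀ (Lς : ℕ), (SmallnessFor γβ β' β₀ Lς Θ.ν.p₀) →
      (γβ * p0Profile Θ.ν.A₀ Θ.ν.p₀ γβ ≤ 1 / 10) →
      (∀ P : B12.RunParams, lam.kSel P < P.K → Step.InInterval γβ P.K (gOfRecord₁₃Ax F 2 (Θ.liveRepin₁₃Ax F 2) P) → N0OfRecord₁₃Ax (Θ.liveRepin₁₃Ax F 2) P (lam.kSel P + 1) ≤ lam.kSel P + 1 → ∀ s, LiveSeq F 2 Θ.ν Θ.τ9 P (gOfRecord₁₃Ax F 2 (Θ.liveRepin₁₃Ax F 2) P) (lam.kSel P + 1)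
        (slotsTOfRecord F 2 Θ.ν Θ.τ9 (EOfRecord₁₃Ax F 2 (Θ.liveRepin₁₃Ax F 2)) (wOfRecord₉ F 2 (Θ.liveRepin₁₃Ax F 2).toStage9Params)
          (Θ.liveRepin₁₃Ax F 2).ppSel P (gOfRecord₁₃Ax F 2 (Θ.liveRepin₁₃Ax F 2) P) (lam.kSel P + 1)) s →
      0 < ∫ V, rterm (reprTOfRecord₁₃Chi F 2 (Θ.liveRepin₁₃Ax F 2) (chiβOfRecord₁₃Ax F 2 Θ) P (lam.kSel P)) s V ∂(fieldMeasure (F.P P.K) (lam.kSel P + 1) (SU 2))) →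
      -- THE TERM PINS (167ᴾ ∕ 12P ✓p516715 §1) in place of the free rows at `λ.D1100 ∕ λ.D189`: data `σ sq Nm p₁ Dst`, then 12P §1's rows run by run below the torus
      ∀ (σ : ∀ P : B12.RunParams, Sit189 F 2 P.K),
      ∀ (sq : ∀ P : B12.RunParams, SeqOfRecord F Θ.ν Θ.τ9.M (gOfRecord₁₃Ax F 2 (Θ.liveRepin₁₃Ax F 2) P) P.K (lam.kSel P + 1)),
      ∀ (Nm : B12.RunParams → ℕ),
      ∀ (p₁ : ℕ),
      (0 < Θ.ν.M₂) →
      (0 < Θ.τ9.M) →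
      ∀ (Dst : ∀ P : B12.RunParams, Setting189 (F.P P.K) (SU 2) (MSField (F.P P.K) (SU 2) × ((j : ℕ) → VecField (F.P P.K) j (EuclideanSpace ℝ (Fin (2 ^ 2 - 1))))) (Pt (F.P P.K).d)),
      (∀ P : B12.RunParams, Dst P = ((ResidW.pinRPrime₁₃Ax lam (Θ.liveRepin₁₃Ax F 2)).pinD189ΛH (Θ.liveRepin₁₃Ax F 2).ν (Θ.liveRepin₁₃Ax F 2).A₁ (Θ.liveRepin₁₃Ax F 2).τ9.M (gOfRecord₁₃Ax F 2 (Θ.liveRepin₁₃Ax F 2)) (fun P => (((((σ P).pinZres Θ.ν Θ.τ9.M (gOfRecord₁₃Ax F 2 (Θ.liveRepin₁₃Ax F 2) P) (sq P) (N0OfRecord₁₃Ax (Θ.liveRepin₁₃Ax F 2) P (lam.kSel P + 1))).pinSides Θ.ν (gOfRecord₁₃Ax F 2 (Θ.liveRepin₁₃Ax F 2) P) (lam.kSel P + 1 - Nm P) (lam.kSel P + 1)).pinXΩ4 (sq P) (enlD F Θ.ν Θ.τ9.M P (gOfRecord₁₃Ax F 2 (Θ.liveRepin₁₃Ax F 2)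 P))).pinOmegaPP (sq P) (Nm P) (enlD F Θ.ν Θ.τ9.M P (gOfRecord₁₃Ax F 2 (Θ.liveRepin₁₃Ax F 2) P)))) sq Nm p₁).D189 P) →
      (∀ P : B12.RunParams, lam.kSel P < P.K → Step.InInterval γβ P.K (gOfRecord₁₃Ax F 2 (Θ.liveRepin₁₃Ax F 2) P) → N0OfRecord₁₃Ax (Θ.liveRepin₁₃Ax F 2) P (lam.kSel P + 1) ≤ lam.kSel P + 1 → N0OfRecord₁₃Ax (Θ.liveRepin₁₃Ax F 2) P (lam.kSel P + 1) ≤ Nm P) →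
      (∀ P : B12.RunParams, lam.kSel P < P.K → 0 ≤ (σ P).β) →
      (∀ P : B12.RunParams, lam.kSel P < P.K → (σ P).β ≤ 1 / 4) →
      (∀ P : B12.RunParams, lam.kSel P < P.K → 2 ≤ (σ P).L₀) →
      (∀ P : B12.RunParams, lam.kSel P < P.K → (σ P).L₀ ^ 2 ≤ ((F.P P.K).L : ℝ)) →
      (∀ P : B12.RunParams, lam.kSel P < P.K → 0 ≤ (σ P).O1 * (σ P).B₃ * (σ P).B₅) →
      (∀ P : B12.RunParams, lam.kSel P < P.K → 0 ≤ (σ P).δ) →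
      (∀ P : B12.RunParams, lam.kSel P < P.K → Step.InInterval γβ P.K (gOfRecord₁₃Ax F 2 (Θ.liveRepin₁₃Ax F 2) P) → N0OfRecord₁₃Ax (Θ.liveRepin₁₃Ax F 2) P (lam.kSel P + 1) ≤ lam.kSel P + 1 → (2 + (121 / 120) ^ 2 * ((σ P).O1 * (σ P).B₃ * (σ P).B₅ * (Θ.τ9.M : ℝ) ^ 5)) *
      ((((σ P).L₀ ^ 2) ^ (N0OfRecord₁₃Ax (Θ.liveRepin₁₃Ax F 2) P (lam.kSel P + 1) - 1))⁻¹) ≤ 1 / 4) →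
      (∀ P : B12.RunParams, lam.kSel P < P.K → (121 / 120) ^ 2 * ((σ P).O1 * (σ P).B₃ * (σ P).B₅ * (Θ.τ9.M : ℝ) ^ 5) * Real.exp (-(4 * (σ P).δ * (Θ.τ9.M : ℝ))) ≤ 1 / 12) →
      (∀ P : B12.RunParams, lam.kSel P < P.K → Step.InInterval γβ P.K (gOfRecord₁₃Ax F 2 (Θ.liveRepin₁₃Ax F 2) P) → N0OfRecord₁₃Ax (Θ.liveRepin₁₃Ax F 2) P (lam.kSel P + 1) ≤ lam.kSel P + 1 → (((enlD F Θ.ν Θ.τ9.M P (gOfRecord₁₃Ax F 2 (Θ.liveRepin₁₃Ax F 2) P)) 4 (lam.kSel P + 1 + 1 - (N0OfRecord₁₃Ax (Θ.liveRepin₁₃Ax F 2) P (lam.kSel P + 1)))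
        (omegaOfChain (sq P) (lam.kSel P + 1 + 1 - (N0OfRecord₁₃Ax (Θ.liveRepin₁₃Ax F 2) P (lam.kSel P + 1)))))ᶜ ∩ (σ P).Z).Nonempty) →
      (∀ P : B12.RunParams, lam.kSel P < P.K → Step.InInterval γβ P.K (gOfRecord₁₃Ax F 2 (Θ.liveRepin₁₃Ax F 2) P) → N0OfRecord₁₃Ax (Θ.liveRepin₁₃Ax F 2) P (lam.kSel P + 1) ≤ lam.kSel P + 1 → ∀ U, new189 (Dst P) U → ∀ p ∈ plaqsOf (half (Dst P)),
      Ineq191 (dist1 (plaqHol ((Dst P).Upp U) p)) ((Dst P).devV'' U p) (Dst P).α (((Dst P).L ^ (Dst P).h)⁻¹) ((Dst P).ε (Dst P).h) (E124 (Dst P).ε (Dst P).L (Dst P).η (Dst P).k (Dst P).h)) →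
      (∀ P : B12.RunParams, lam.kSel P < P.K → Step.InInterval γβ P.K (gOfRecord₁₃Ax F 2 (Θ.liveRepin₁₃Ax F 2) P) → N0OfRecord₁₃Ax (Θ.liveRepin₁₃Ax F 2) P (lam.kSel P + 1) ≤ lam.kSel P + 1 → ∀ U, new189 (Dst P) U → ∀ p ∈ plaqsOf (half (Dst P)),
      Ineq195 ((Dst P).devV'' U p) (dist1 (plaqHol ((Dst P).Uhalf U ((Dst P).boxOf p)) p)) (Dst P).α (((Dst P).L ^ (Dst P).h)⁻¹) ((Dst P).ε (Dst P).h) (E124 (Dst P).ε (Dst P).L (Dst P).η (Dst P).k (Dst P).h)) →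
      (∀ P : B12.RunParams, lam.kSel P < P.K → Step.InInterval γβ P.K (gOfRecord₁₃Ax F 2 (Θ.liveRepin₁₃Ax F 2) P) → N0OfRecord₁₃Ax (Θ.liveRepin₁₃Ax F 2) P (lam.kSel P + 1) ≤ lam.kSel P + 1 → ∀ U, new189 (Dst P) U → ∀ j, (Dst P).h ≤ j → j ≤ (Dst P).k → ∀ p ∈ plaqsOf (dom (Dst P) j),
      Ineq191 (dist1 (plaqHol ((Dst P).Upp U) p)) ((Dst P).dev97 U p) (Dst P).α (((Dst P).L ^ j)⁻¹) ((Dst P).ε j) (E124 (Dst P).ε (Dst P).L (Dst P).η (Dst P).k j)) →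
      (∀ P : B12.RunParams, lam.kSel P < P.K → Step.InInterval γβ P.K (gOfRecord₁₃Ax F 2 (Θ.liveRepin₁₃Ax F 2) P) → N0OfRecord₁₃Ax (Θ.liveRepin₁₃Ax F 2) P (lam.kSel P + 1) ≤ lam.kSel P + 1 → ∀ U, new189 (Dst P) U → ∀ j, (Dst P).h ≤ j → j ≤ (Dst P).k → ∀ p ∈ plaqsOf (dom (Dst P) j),
      Ineq191 ((Dst P).dev97 U p) ((Dst P).dev0 U p) (Dst P).α (((Dst P).L ^ j)⁻¹) ((Dst P).ε j) (E124 (Dst P).ε (Dst P).L (Dst P).η (Dst P).k j)) →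
      (∀ P : B12.RunParams, lam.kSel P < P.K → Step.InInterval γβ P.K (gOfRecord₁₃Ax F 2 (Θ.liveRepin₁₃Ax F 2) P) → N0OfRecord₁₃Ax (Θ.liveRepin₁₃Ax F 2) P (lam.kSel P + 1) ≤ lam.kSel P + 1 → ∀ U, new189 (Dst P) U → ∀ j, (Dst P).h ≤ j → j ≤ (Dst P).k → ∀ p ∈ plaqsOf (dom (Dst P) j),
      Ineq180 ((Dst P).dev0 U p) ((Dst P).ε (Dst P).k) (Dst P).η (Dst P).B₃ (Dst P).B₅ (Dst P).M (Dst P).δ ((Dst P).dist p) (Dst P).O1) →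
      (∀ (P : B12.RunParams) (i : ι P), ∀ (ν' : Fin (F.P P.K).d), ∀ z ∈ box (fun κ => (hi P i κ - lo P i κ + 1).toNat + 3) (fun κ => lo P i κ - 2),
      (castSite z : Site (F.P P.K) (k P i)) ∈ pts (k P i) (maxDomT Θ.ν.M₁ (Z P i) (k P i)) ∧
        (castSite z : Site (F.P P.K) (k P i)).shift ⟨0, h0 P⟩ ∈ pts (k P i) (maxDomT Θ.ν.M₁ (Z P i) (k P i)) ∧
        (castSite z : Site (F.P P.K) (k P i)).shift ν' ∈ pts (k P i) (maxDomT Θ.ν.M₁ (Z P i) (k P i))) →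
      (∀ P : B12.RunParams, (143 * (((((F.P P.K).d + 4 : ℕ) : ℝ)) ^ 2 / 4) ^ 2) * (Θ.ν.εreg * (F.P P.K).L ^ 2) ≤ 1 / 3) →
      (∀ P : B12.RunParams, 2 * (Θ.ν.εreg * (F.P P.K).L ^ 2) ≤ 2 * deltaSU (Fin 2) / ((((F.P P.K).d + 4) * (F.P P.K).L : ℕ) : ℝ) ^ 2) →
      (∀ P : B12.RunParams, (((((F.P P.K).d + 2) * (F.P P.K).L : ℕ) : ℝ) ^ 2 / 4) * (2 * (Θ.ν.εreg * (F.P P.K).L ^ 2)) < deltaSU (Fin 2)) →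
      (∀ (P : B12.RunParams) (i : ι P), ∀ x ∈ X P i, ∃ x₀ ∈ maxDomT Θ.ν.M₁ (Z P i) (k P i), ∃ w₀ : List (Letter (F.P P.K).d), w₀.length ≤ D₀ P i ∧ walkEnd x₀ w₀ = x) →
      (∀ (P : B12.RunParams) (i : ι P), D₀ P i + 3 * (∑ i' ∈ Finset.range (k P i + 1), ((F.P P.K).d * (((F.P P.K).L ^ i' - 1) / 2) + 1)) + ((3 * ((F.P P.K).d * (((F.P P.K).L - 1) / 2)) + 5) + 5) * (F.P P.K).L ^ k P i +
      (((F.P P.K).d + 4) * (F.P P.K).L + 2) * (∑ l ∈ Finset.Ico 0 (k P i), (F.P P.K).L ^ l) + 4 ≤ (F.P P.K).L ^ (k P i - 1) * Θ.ν.M₁) →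
      (∀ P : B12.RunParams, 4 * (F.P P.K).L ≤ Θ.ν.M₁) →
      (∀ (P : B12.RunParams) (i : ι P) (y : Site (F.P P.K) 0), B14.Eq22Determines.blockIter (k P i) y ∈ (castSite '' Set.Icc (lo P i - 1) (hi P i + 1) : Set (Site (F.P P.K) (k P i))) → y ∈ maxDomT Θ.ν.M₁ (Z P i) 1) →
      (∀ (P : B12.RunParams) (i : ι P), side (F.P P.K).L Θ.ν.M₁ (k P i) ∣ (F.P P.K).sitesPerDir 0) →
      (∀ (P : B12.RunParams) (i : ι P), 1 / 2 * (B₃ * (cE P + 1) * (F.P P.K).eta 1 ^ 2) ^ 2 * (Nat.card {q : Plaq (F.P P.K) 0 // q ∈ plaqsOf (maxDomT Θ.ν.M₁ (Z P i) 1)} : ℝ) ≤ cA P) →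
      (2 ≤ Θ.ν.M₁) →
      (0 < Θ.ν.εreg) →
      (Θ.ν.εreg ≤ a₀) →
      -- THE GUARD CAP `eG` and the cap-level datum tolerance `ρnG` with the head's rows at the cap (all upper bounds on `eG`, `ρnG`, `Θ.ν.εreg`)
      ∀ (eG ρnG : ∀ P : B12.RunParams, ι P → ℝ), (∀ (P : B12.RunParams) (i : ι P), 0 < eG P i) →
      (∀ (P : B12.RunParams) (i : ι P), 6 * ((((F.P P.K).d - 1 : ℕ)) : ℝ) * (F.P P.K).L ^ (k P i) * (2 * ((cE P + 1) * eG P i)) ≤ ρJ P i) →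
      (∀ (P : B12.RunParams) (i : ι P), 12 * ((((F.P P.K).d - 1 : ℕ)) : ℝ) * (F.P P.K).L * Θ.ν.εreg ≤ ρJ P i) →
      (∀ (P : B12.RunParams) (i : ι P), Θ.ν.εreg ≤ εW P i) →
      (∀ P : B12.RunParams, (143 * (((((F.P P.K).d + 4 : ℕ) : ℝ)) ^ 2 / 4) ^ 2) * (2 * ((F.P P.K).L : ℝ) ^ 2 * Θ.ν.εreg) ≤ 1 / 3) →
      (∀ P : B12.RunParams, 2 * (2 * ((F.P P.K).L : ℝ) ^ 2 * Θ.ν.εreg) ≤ 2 * deltaSU (Fin 2) / ((((F.P P.K).d + 4) * (F.P P.K).L : ℕ) : ℝ) ^ 2) →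
      (∀ (P : B12.RunParams) (i : ι P), (cE P + 1) * (2 * eG P i) ≤ a₁' ∧ B₃ * ((cE P + 1) * (2 * eG P i)) ≤ Θ.ν.εreg) →
      (Θ.ν.εreg < a₀) →
      (∀ (P : B12.RunParams) (i : ι P), 0 ≤ ρnG P i) →
      (∀ (P : B12.RunParams) (i : ι P), max (ρnG P i) ((((2 * (∑ i' ∈ Finset.range (k P i + 1), ((F.P P.K).d * (((F.P P.K).L ^ i' - 1) / 2) + 1)) + 1 +
                  (3 * ((F.P P.K).d * (((F.P P.K).L - 1) / 2)) + 5) * (F.P P.K).L ^ (k P i) : ℕ) : ℝ)) ^ 2 / 4 * (Θ.ν.εreg * (F.P P.K).eta 0 ^ 2) +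
                ((3 * ((F.P P.K).d * (((F.P P.K).L - 1) / 2)) + 5 : ℕ) : ℝ) * (6 * ((((((F.P P.K).d + 2) * (F.P P.K).L : ℕ) : ℝ) ^ 2 / 4) * (2 * (Θ.ν.εreg * (F.P P.K).L ^ 2))) * ∑ i' ∈ Finset.range (k P i), ((F.P P.K).L : ℝ) ^ i') + ((3 * ((F.P P.K).d * (((F.P P.K).L - 1) / 2)) + 5 : ℕ) : ℝ) * ρnG P i) ≤ δ₀ P i) →
      (∀ (P : B12.RunParams) (i : ι P), (((F.P P.K).d : ℝ) * n' P i + 1) * ((((F.P P.K).d - 1 : ℕ) : ℝ) * n' P i * ((12 * (F.P P.K).d * (n P i + 2) ^ 2 + 1) * eG P i) + 3 * (F.P P.K).d * (n P i + 2) ^ 2 * eG P i) ≤ ρnG P i) →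
      -- THE (J0′) RADIUS, announced BEFORE the data budget `eR`
      ∃ R : ∀ P : B12.RunParams, ι P → ℝ, (∀ P i, 0 < R P i) ∧
      ∀ (eR : ∀ P : B12.RunParams, ι P → ℝ), (∀ (P : B12.RunParams) (i : ι P), 0 < eR P i) → (∀ (P : B12.RunParams) (i : ι P), eR P i ≤ eG P i) →
      ∀ (ρn : ∀ P : B12.RunParams, ι P → ℝ),
      (∀ (P : B12.RunParams) (i : ι P), (((F.P P.K).d : ℝ) * n' P i + 1) * ((((F.P P.K).d - 1 : ℕ) : ℝ) * n' P i * ((12 * (F.P P.K).d * (n P i + 2) ^ 2 + 1) * eR P i)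
      + 3 * (F.P P.K).d * (n P i + 2) ^ 2 * eR P i) ≤ ρn P i) →
      ∀ (cJ : B12.RunParams → ℝ), (∀ P : B12.RunParams, 0 ≤ cJ P) →
      (∀ (P : B12.RunParams) (i : ι P), (cE P + 1) * (2 * eR P i) ≤ a₁' ∧ B₃ * ((cE P + 1) * (2 * eR P i)) ≤ Θ.ν.εreg) →
      (∀ (P : B12.RunParams) (i : ι P), 6 * ((((F.P P.K).d - 1 : ℕ)) : ℝ) * (F.P P.K).L * (2 * B₃ * (cE P + 1) * eR P i) ≤ ρ5 P i) →
      (∀ (P : B12.RunParams) (i : ι P), 6 * ((((F.P P.K).d - 1 : ℕ)) : ℝ) * (F.P P.K).L * (2 * B₃ * (cE P + 1) * eR P i) ≤ ρ6 P i) →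
      (∀ (P : B12.RunParams) (i : ι P), 2 * cA P * eR P i / R P i + 2 * ((Nat.card {q : Plaq (F.P P.K) 0 // q ∈ plaqsOf (maxDomT Θ.ν.M₁ (Z P i) 1)} : ℝ) * (1 + 8 * (4 * 𝓐₁) ^ 4)) / (R P i * eR P i) ≤ cJ P) →

    ∀ δ : ∀ P : B12.RunParams, ι P → ℝ, (∀ P i, 0 < δ P i) →
      -- the endpoint's EXPLICIT THRESHOLD per run (every quantity a displayed binder or a count of the run's instance — no `∃ δ₀`), then its TOLERANCE rows at `δ P i`
      (∀ (P : B12.RunParams) (i : ι P), δ P i ≤ min (min (min (ρ P i) (ρτ P i) / 2)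
        (min 1 (1 / 2 / (2 * (3 * (Kb P i : ℝ) ^ 2 + 2 * (Kb P i : ℝ) ^ 4)) /
          (max ((32 * (((F.P P.K).d : ℝ) - 1) + 8 * (((F.P P.K).d : ℝ) - 1) + (2 * (((F.P P.K).d : ℝ) - 1) * B₁ P i * (((∑ j ∈ Finset.range (k P i + 1), (2 * (F.P P.K).d) ^ j : ℕ) : ℝ) * M₂ P i))) * (12 * (4 * 𝓐₁) / R P i * Real.sqrt (Nat.card {b : PBond (F.P P.K) 0 // b ∈ {b : PBond (F.P P.K) 0 | b.src ∈ maxDomT Θ.ν.M₁ (Z P i) 1 ∨ b.tgt ∈ maxDomT Θ.ν.M₁ (Z P i) 1}})) ^ 2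
            + (8 * (((F.P P.K).d : ℝ) + 1) * (2 * (Kτ P i + 1)) + 8 * ((F.P P.K).d : ℝ) * (((box (fun κ => (hi P i κ - lo P i κ + 1).toNat + 3) (fun κ => lo P i κ - 2)).image (fun z => (castSite z : Site (F.P P.K) (k P i)))).card : ℝ) * (C P i * (12 * (4 * 𝓐₁) / R P i * Real.sqrt (Nat.card {b : PBond (F.P P.K) 0 // b ∈ {b : PBond (F.P P.K) 0 | b.src ∈ maxDomT Θ.ν.M₁ (Z P i) 1 ∨ b.tgt ∈ maxDomT Θ.ν.M₁ (Z P i) 1}}))) ^ 2)) 0 + 1)))) (εH P i)) →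
      ∀ (hfloor : ∀ (P : B12.RunParams) (i : ι P), ((((4 * (F.P P.K).d + (3 * ((F.P P.K).d * (((F.P P.K).L - 1) / 2)) + 5) + 3 : ℕ) : ℝ)) ^ 2 * ((F.P P.K).L : ℝ) ^ 2 / 4 + ((3 * ((F.P P.K).d * (((F.P P.K).L - 1) / 2)) + 5 : ℕ) : ℝ) * (24 * (((((F.P P.K).d + 2) * (F.P P.K).L : ℕ) : ℝ) ^ 2 / 4))) * (2 * B₃ * (cE P + 1) * eR P i) + ((3 * ((F.P P.K).d * (((F.P P.K).L - 1) / 2)) + 5 : ℕ) : ℝ) * ρn P i ≤ δ P i),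
      ∃ (lamW : ResidW F 2) (γ₁₂ : ℝ), 0 < γ₁₂ ∧ (∀ P : B12.RunParams, 1 ≤ P.K → lamW.kSel P < P.K) ∧
        ∀ P : B12.RunParams, lamW.kSel P < P.K → Step.InInterval γ₁₂ P.K (gOfRecord₁₃Ax F 2 (Θ.liveRepin₁₃Ax F 2) P) →
          N0OfRecord₁₃Ax (Θ.liveRepin₁₃Ax F 2) P (lamW.kSel P + 1) ≤ lamW.kSel P + 1 →
          B15Leaf (WOfRecord₁₃Ax F 2 (Θ.liveRepin₁₃Ax F 2) lamW P) := by
  obtain ⟨ρJ, εW, δ₀, hρJ, hεW, hδ₀, C, ρ, Kτ, ρτ, ρ5, εH, B₁, ρ6, M₂, hC, hρ, hKτ, hρτ, hρ5, hεH, hB1, hρ6, hM₂0, hmain⟩ :=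
    exists_constants_thresholds_radius_areg_pinLF_b15Leaf_WOfRecord₁₃_pinAllΛΩχZ_N0_liveRepin₁₃_memGuardedRowsDatumScale_lettersDischargedAtLength_termPinned_ofRegNameGB_ofStepGB_ax
      hd3 h0 ι Z Λ k M hk0 hk1 T lo hi n hn hN hbox hZ hTG0 hN5 Kb hK1 hKn ext hext hlohi LO HI hLO hHI n' hn' hn'N hR' hγ hbx hbxM hM W hWbox c hkc hc X D₀ hBox hWX hfeedsX hcE0 hcE hγle hZblk hB₃ Adm h15 hAdmK hAdmTr ν₀ hdiv₀ hfloor₀ hMrad₀ hM₁₀ hadm₀ hscope 𝓐₁ h𝓐₁ hC₁ hCB hstep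
  refine ⟨ρJ, εW, δ₀, hρJ, hεW, hδ₀, C, ρ, Kτ, ρτ, ρ5, εH, B₁, ρ6, M₂, hC, hρ, hKτ, hρτ, hρ5, hεH, hB1, hρ6, hM₂0, ?_⟩
  intro Θ lam hk hν₀ hres β₀ bβ γβ tb tlow hr1 hA₀ β' tup Lς tS t10 hmassLive σ sq Nm p₁ tM₂ tMτ Dst hDst tNN tβ0 tβ tL₀ tL₀L tB tδ tN₀ tMl tΛ L91h L95 L91 L97 L80
    hΩw hα3 hα2 haN hXΩ hfit hM4 hZ1 hdiv hcA hM2 hεreg ha₀ eG ρnG heG hρJ1 hρJ2 hεWr hα3h hα2h haG ha₀s hρnG0 hT hnormG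
  obtain ⟨R, hR, hrest⟩ := hmain Θ lam hν₀ hres β₀ bβ γβ tb tlow hr1 hA₀ β' tup Lς tS t10 hmassLive σ sq Nm p₁ tM₂ tMτ Dst hDst tNN tβ0 tβ tL₀ tL₀L tB tδ tN₀ tMl tΛ
    L91h L95 L91 L97 L80 hΩw hα3 hα2 haN hXΩ hfit hM4 hZ1 hdiv hcA hM2 hεreg ha₀ eG ρnG heG hρJ1 hρJ2 hεWr hα3h hα2h haG ha₀s hρnG0 hT hnormG
  refine ⟨R, hR, ?_⟩
  intro eR heR heRG ρn hρn cJ hcJ heRa hερ hερ6 hcJ' δ hδ hδle hfloor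
  obtain ⟨areg, hapos, hleaf⟩ := hrest eR heR heRG ρn hρn cJ hcJ heRa hερ hερ6 hcJ' δ hδ hδle hfloor
  -- THE BILL's WITNESSES: `λW := λᴾ` (the fully pinned layer of the junction, verbatim) at the step `kSel P = P.K − 1`, `γ₁₂ := γβ` (the level of the displayed β-sign box)
  exact ⟨((ResidW.pinRPrime₁₃Ax { lam with LF := fun P => lfVarOn su2Chart fun i => InstOn.stdB (Node00.bgMSCoPOfRecordB F 2 Θ.ν P.K (k P i) (maxDomT Θ.ν.M₁ (Z P i))) Θ.ν.M₁ lamDatumP (Z P i) (Λ P i) (k P i) (M P i) (areg P i) (anExt (pts (k P i) (Λ P i)) (T P i) (fun177stdB (Node00.bgMSCoPOfRecordB F 2 Θ.ν P.K (k P i) (maxDomT Θ.ν.M₁ (Z P i))) Θ.ν.M₁ lamDatumP (Z P i) (k P i)) (ext P i) (min (1 / 2) (min (R P i / 8) (γ₈ P / (M P i) ^ 5 * (R P i / 2) ^ 2 / (48 * (4 * ((Nat.card {q : Plaq (F.P P.K) 0 // q ∈ plaqsOf (maxDomT Θ.ν.M₁ (Z P i) 1)} : ℝ) * (1 + 8 *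 (4 * 𝓐₁) ^ 4)) / R P i + 1)))))) } (Θ.liveRepin₁₃Ax F 2)).pinD189ΛH (Θ.liveRepin₁₃Ax F 2).ν (Θ.liveRepin₁₃Ax F 2).A₁ (Θ.liveRepin₁₃Ax F 2).τ9.M (gOfRecord₁₃Ax F 2 (Θ.liveRepin₁₃Ax F 2)) (fun P => (((((σ P).pinZres Θ.ν Θ.τ9.M (gOfRecord₁₃Ax F 2 (Θ.liveRepin₁₃Ax F 2) P) (sq P) (N0OfRecord₁₃Ax (Θ.liveRepin₁₃Ax F 2) P (lam.kSel P + 1))).pinSides Θ.ν (gOfRecord₁₃Ax F 2 (Θ.liveRepin₁₃Ax F 2) P) (lam.kSel P + 1 - Nm P) (lam.kSel P + 1)).pinXΩ4 (sq P) (enlD F Θ.ν Θ.τ9.M P (gOfRecord₁₃Ax F 2 (Θ.liveRepin₁₃Ax F 2) P))).pinOmegaPP (sq P) (Nm P) (enlD F Θ.ν Θ.τ9.M P (gOfRecord₁₃Ax F 2 (Θ.liveRepin₁₃Ax F 2) P)))) sq Nm p₁),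
    γβ, tS.γ_pos, fun P hP => by show lam.kSel P < P.K; rw [hk P]; omega, hleaf⟩


end

end Summit.QuantumFields.YangMills.BalabanUVNodes.N12BillH12ForStub1VWK1AxV11OfJunctionRowsMemGuarded

end
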